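import Mathlib.RingTheory.LaurentSeries
import Literature.Barriers.ValiantsHypothesis.BIJL18MatrixCompletion
import Literature.Computability.AlgebraicComplexity.NonscalarBorderRank

/-!
# Bläser–Ikenmeyer–Jindal–Lysikov 2018, Proposition 19 — PROVED (`BIJL2018_prop19_holds`)

Discharge of the named fact `BIJL2018_prop19` of `BIJL18MatrixCompletion.lean` (val-lit row
BIJL2018-A; M. Bläser, C. Ikenmeyer, G. Jindal, V. Lysikov, *Generalized matrix completion and
algebraic natural proofs*, STOC 2018 / ECCC TR18-064, Prop. 19): if `rk A₁ = ⋯ = rk A_m = 1` then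
`\underline{R}(t) ≤ \underline{CR}(t) + m` for `t = (A₀, A₁, …, A_m)` — border tensor rank (the
tree's algebraic border rank `algBorderRank` over `K[ε]`, Bläser Def. 6.1) is at most the border
completion rank (BIJL Def. 9, the tree's `borderCompletionRank` over `K(ε)`) plus `m`,
[cite: BlaserIkenmeyerJindalLysikov2018, Prop. 19].

The proof is the printed one (ECCC p. 12–13): from a border witness `Ãᵢ = Aᵢ + O(ε)`,
`rk Ã_k ≤ 1`, `rk(Ã₀ + Σ λ_k Ã_k) ≤ r` over `K(ε)`, write `Ã₀ + Σ λ_k Ã_k = Σ_{s<r} x_s ⊗ y_s`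
and `Ã_k = u_k ⊗ v_k` (`BIJL2018_obs15` over the field `K(ε)`), so that
`t̃ = Σ_s e₀ ⊗ x_s ⊗ y_s + Σ_k (e_k - λ_k e₀) ⊗ u_k ⊗ v_k` exactly, with `t̃ = t + O(ε)`; the
passage "`+ O(ε)`, therefore `\underline{R}(t) ≤ r + m`" is the tree's clearing-of-denominators
lemma `algBorderRank_le_of_laurentSeries` (`NonscalarBorderRank.lean`) after pushing `K(ε)` into
the Laurent series field `K((ε))`, where `Ã = A + O(ε)` in the sense of Def. 9 (`IsApproxOf`:
reduced denominator non-vanishing at `0` and value `A` at `0`) becomes `IsOrdGE 1 (Ã - A)`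
(`isOrdGE_one_coe_sub_C_of_isApproxOf`).

Theorem-only file. Honest framing: a discharge of typed literature (net debt −1); VP ≠ VNP is
NOT proved and nothing here is progress on it.

## References
* [BlaserIkenmeyerJindalLysikov2018] M. Bläser, C. Ikenmeyer, G. Jindal, V. Lysikov, STOC 2018,
  doi:10.1145/3188745.3188832; ECCC TR18-064, §4, Prop. 19 and its proof (p. 12–13).
* [Blaser2013] M. Bläser, *Fast Matrix Multiplication*, ToC Graduate Surveys 5, Def. 6.1.
-/

noncomputable section

open scoped BigOperators Polynomial RatFunc

namespace Literature.Barriers.ValiantsHypothesis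

open Literature.Computability.AlgebraicComplexity Matrix

universe u

variable {K : Type u} [Field K]

namespace Prop19

/-- Rank does not increase under an (injective) change of scalars along a field homomorphism
(via vanishing minors). [cite: BlaserIkenmeyerJindalLysikov2018, Def. 9] -/
theorem rank_map_le_rank {L : Type*} [Field L] {m₁ n₁ : Type*} [Fintype m₁] [Fintype n₁]
    (f : K →+* L) (A : Matrix m₁ n₁ K) : (A.map f).rank ≤ A.rank := by
  classical
  refine Literature.LinearAlgebra.Matrix.rank_le_of_det_submatrix_eq_zero _ fun r c => ?_
  rw [Matrix.submatrix_map, ← RingHom.mapMatrix_apply, ← RingHom.map_det,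
    Literature.LinearAlgebra.Matrix.det_submatrix_eq_zero_of_rank_lt_card A r c (by simp),
    map_zero]

/-! ### `Ã = A + O(ε)` in `K(ε)` gives `Ã - A = O(ε)` in `K((ε))` -/

/-- A rational function whose reduced denominator does not vanish at `0` and whose value at `0`
is `a` is `a + O(ε)` as a Laurent series. [cite: BlaserIkenmeyerJindalLysikov2018, Def. 9] -/
theorem isOrdGE_one_coe_sub_C_of_isApproxOf {a : K} {f : RatFunc K} (h : IsApproxOf a f) :
    IsOrdGE 1 ((f : LaurentSeries K) - HahnSeries.C a) := by
  obtain ⟨hden, hval⟩ := h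
  set p : K[X] := f.num with hp
  set q : K[X] := f.denom with hq
  -- `q` is a unit of `K⟦ε⟧`
  have hq0 : PowerSeries.constantCoeff (q : PowerSeries K) ≠ 0 := by
    rwa [Polynomial.constantCoeff_coe, Polynomial.coeff_zero_eq_eval_zero]
  have hqu : IsUnit (q : PowerSeries K) :=
    PowerSeries.isUnit_iff_constantCoeff.2 (isUnit_iff_ne_zero.2 hq0)
  obtain ⟨uq, huq⟩ := hqu
  -- `f = p · q⁻¹` as a power series
  set g : PowerSeries K := (p : PowerSeries K) * ↑uq⁻¹ with hg
  have hcoe : (f : LaurentSeries K) = HahnSeries.ofPowerSeries ℤ K g := by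
    have hf : (f : LaurentSeries K) = algebraMap K[X] (LaurentSeries K) p /
        algebraMap K[X] (LaurentSeries K) q := by
      rw [show (f : LaurentSeries K) = algebraMap (RatFunc K) (LaurentSeries K) f from rfl,
        hp, hq, ← RatFunc.algebraMap_apply_div, RatFunc.num_div_denom]
    rw [hf, Polynomial.algebraMap_hahnSeries_apply, Polynomial.algebraMap_hahnSeries_apply,
      div_eq_iff, hg, ← huq, map_mul, mul_assoc, ← map_mul, Units.inv_mul, map_one, mul_one]
    rw [← huq]
    intro h0
    have := congrArg (fun x : LaurentSeries K => x * HahnSeries.ofPowerSeries ℤ K (↑uq⁻¹ : PowerSeries K)) h0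
    simp only [← map_mul, Units.mul_inv, map_one, zero_mul] at this
    exact one_ne_zero this
  -- constant coefficient of `g` is `f(0) = a`
  have hg0 : PowerSeries.constantCoeff g = a := by
    have hq0' : PowerSeries.constantCoeff (↑uq : PowerSeries K) ≠ 0 := by rwa [huq]
    have hinv : PowerSeries.constantCoeff (↑uq⁻¹ : PowerSeries K) =
        (PowerSeries.constantCoeff (↑uq : PowerSeries K))⁻¹ := by
      have h1 : PowerSeries.constantCoeff (↑uq : PowerSeries K) *
          PowerSeries.constantCoeff (↑uq⁻¹ : PowerSeries K) = 1 := by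
        rw [← map_mul, Units.mul_inv, map_one]
      field_simp
      rw [mul_comm] at h1
      exact h1
    rw [hg, map_mul, hinv, huq, Polynomial.constantCoeff_coe, Polynomial.constantCoeff_coe,
      ← hval, RatFunc.eval, Polynomial.eval₂_id, Polynomial.eval₂_id, ← hp, ← hq,
      Polynomial.coeff_zero_eq_eval_zero, Polynomial.coeff_zero_eq_eval_zero, div_eq_mul_inv]
  -- conclusion
  intro i hi
  rw [HahnSeries.coeff_sub, hcoe, PowerSeries.coeff_coe, HahnSeries.C_apply,
    HahnSeries.coeff_single]
  by_cases hi0 : i = 0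
  · subst hi0
    simp [hg0]
  · rw [if_pos (by omega), if_neg hi0, sub_zero]

/-! ### The decomposition of the approximating tensor -/

/-- From a border witness: `Ã₀ + Σ λ_k Ã_k = Σ_{s<r} x_s ⊗ y_s` and `Ã_k = u_k ⊗ v_k` give
`r + m` triads over `K((ε))` summing to the approximating tensor, hence to `t + O(ε)`
(printed proof of Prop. 19). [cite: BlaserIkenmeyerJindalLysikov2018, Prop. 19 (proof)] -/
theorem exists_triads_of_isBorderWitness {n m r : ℕ} {A₀ : Matrix (Fin n) (Fin n) K}
    {A : Fin m → Matrix (Fin n) (Fin n) K} (hA : ∀ k, (A k).rank = 1)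
    {B₀ : Matrix (Fin n) (Fin n) (RatFunc K)} {B : Fin m → Matrix (Fin n) (Fin n) (RatFunc K)}
    {c : Fin m → RatFunc K} (hw : IsBorderWitness A₀ A r B₀ B c) :
    ∃ (w : Fin (r + m) → Option (Fin m) → LaurentSeries K)
      (u v : Fin (r + m) → Fin n → LaurentSeries K),
      ∀ o i j, IsOrdGE 1 (∑ ρ, w ρ o * u ρ i * v ρ j -
        HahnSeries.C (slicesTensor K A₀ A o i j)) := by
  classical
  obtain ⟨hB₀, hB, -, hBrank, hr⟩ := hw
  -- factorisations over the field `K(ε)`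
  obtain ⟨U, V, hUV⟩ := exists_eq_transpose_mul_of_rank_le (RatFunc K) (pencilEval B₀ B c) hr
  have hBk : ∀ k, ∃ U₁ V₁ : Matrix (Fin 1) (Fin n) (RatFunc K), B k = U₁.transpose * V₁ :=
    fun k => exists_eq_transpose_mul_of_rank_le (RatFunc K) (B k) ((hBrank k).trans (hA k).le)
  choose U₁ V₁ hUV₁ using hBk
  set φ : RatFunc K →+* LaurentSeries K := algebraMap (RatFunc K) (LaurentSeries K) with hφ
  set e : Fin r ⊕ Fin m ≃ Fin (r + m) := finSumFinEquiv with he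
  -- the triads, indexed by `Fin r ⊕ Fin m`, transported to `Fin (r + m)`
  set w' : Fin r ⊕ Fin m → Option (Fin m) → LaurentSeries K := fun s => Sum.elim
      (fun (_ : Fin r) (o : Option (Fin m)) => if o = none then (1 : LaurentSeries K) else 0)
      (fun (k : Fin m) (o : Option (Fin m)) =>
        (if o = some k then (1 : LaurentSeries K) else 0) - (if o = none then φ (c k) else 0)) s
    with hw'
  set u' : Fin r ⊕ Fin m → Fin n → LaurentSeries K := fun s =>
      Sum.elim (fun l i => φ (U l i)) (fun k i => φ (U₁ k 0 i)) s with hu'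
  set v' : Fin r ⊕ Fin m → Fin n → LaurentSeries K := fun s =>
      Sum.elim (fun l j => φ (V l j)) (fun k j => φ (V₁ k 0 j)) s with hv'
  refine ⟨fun ρ => w' (e.symm ρ), fun ρ => u' (e.symm ρ), fun ρ => v' (e.symm ρ), fun o i j => ?_⟩
  -- the sum is the `(o, i, j)` entry of the approximating tensor, pushed to `K((ε))`
  have hM : ∀ i j, φ (B₀ i j) + ∑ k, φ (c k) * φ (B k i j) = ∑ l, φ (U l i) * φ (V l j) := by
    intro i j
    have := congr_fun (congr_fun hUV i) j
    simp only [pencilEval, Matrix.add_apply, Matrix.sum_apply, Matrix.smul_apply, smul_eq_mul,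
      Matrix.mul_apply, Matrix.transpose_apply] at this
    have h2 := congrArg φ this
    simp only [map_add, map_sum, map_mul] at h2
    exact h2
  have hBk' : ∀ k i j, φ (B k i j) = φ (U₁ k 0 i) * φ (V₁ k 0 j) := by
    intro k i j
    have := congr_fun (congr_fun (hUV₁ k) i) j
    simp only [Matrix.mul_apply, Matrix.transpose_apply, Fin.sum_univ_one] at this
    rw [this, map_mul]
  have hsum : ∑ ρ, w' (e.symm ρ) o * u' (e.symm ρ) i * v' (e.symm ρ) j =
      φ ((o.elim B₀ B : Matrix (Fin n) (Fin n) (RatFunc K)) i j) := by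
    rw [show ∑ ρ, w' (e.symm ρ) o * u' (e.symm ρ) i * v' (e.symm ρ) j =
        ∑ s, w' s o * u' s i * v' s j from Equiv.sum_comp e.symm (fun s => w' s o * u' s i * v' s j),
      Fintype.sum_sum_type]
    simp only [hw', hu', hv', Sum.elim_inl, Sum.elim_inr]
    cases o with
    | none =>
      simp only [if_true, reduceCtorEq, if_false, zero_sub, one_mul, neg_mul]
      have key := hM i j
      simp only [hBk'] at key
      simp only [Option.elim, Finset.sum_neg_distrib, mul_assoc] at key ⊢
      linear_combination -key
    | some k' =>
      simp only [reduceCtorEq, if_false, zero_mul, Finset.sum_const_zero, zero_add, sub_zero,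
        Option.some.injEq]
      rw [Option.elim, hBk' k' i j, Finset.sum_eq_single k']
      · simp
      · intro k _ hk
        rw [if_neg (Ne.symm hk), zero_mul, zero_mul]
      · simp
  rw [hsum, slicesTensor]
  -- `IsApproxOf` gives `O(ε)`
  cases o with
  | none => exact isOrdGE_one_coe_sub_C_of_isApproxOf (hB₀ i j)
  | some k => exact isOrdGE_one_coe_sub_C_of_isApproxOf (hB k i j)

end Prop19

open Prop19

/-! ### Proposition 19 -/

variable (K) in
/-- **BIJL 2018, Proposition 19 holds**: for rank-one slices `A₁, …, A_m`,
`\underline{R}(t) ≤ \underline{CR}(t) + m`. Discharge of the named fact `BIJL2018_prop19`.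
[cite: BlaserIkenmeyerJindalLysikov2018, Prop. 19] -/
theorem BIJL2018_prop19_holds : BIJL2018_prop19 K := by
  intro n m A₀ A hA
  classical
  -- an optimal border witness
  have hne : {r | ∃ (B₀ : Matrix (Fin n) (Fin n) (RatFunc K))
      (B : Fin m → Matrix (Fin n) (Fin n) (RatFunc K)) (c : Fin m → RatFunc K),
      IsBorderWitness A₀ A r B₀ B c}.Nonempty := by
    by_contra h
    rw [Set.not_nonempty_iff_eq_empty] at h
    have h1 := borderCompletionRank_le_completionRank A₀ A
    have h2 : borderCompletionRank A₀ A = 0 := by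
      rw [borderCompletionRank, h, Nat.sInf_empty]
    -- with the empty witness set, `borderCompletionRank_le_completionRank` was proved from a
    -- witness: rebuild that witness to get a contradiction
    obtain ⟨c, hc⟩ := exists_rank_pencilEval_eq_completionRank A₀ A
    have hwit : IsBorderWitness A₀ A (completionRank A₀ A) (A₀.map RatFunc.C)
        (fun k => (A k).map RatFunc.C) (fun k => RatFunc.C (c k)) := by
      refine ⟨isMatrixApproxOf_map_C A₀, fun k => isMatrixApproxOf_map_C (A k), ?_, fun k => ?_, ?_⟩
      · exact rank_map_le_rank _ _
      · exact rank_map_le_rank _ _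
      · rw [pencilEval_map_C]
        exact (rank_map_le_rank _ _).trans hc.le
    have : completionRank A₀ A ∈ (∅ : Set ℕ) := by
      rw [← h]
      exact ⟨_, _, _, hwit⟩
    exact this
  obtain ⟨B₀, B, c, hw⟩ := Nat.sInf_mem hne
  obtain ⟨w, u, v, h⟩ := exists_triads_of_isBorderWitness hA hw
  exact algBorderRank_le_of_laurentSeries _ w u v h

end Literature.Barriers.ValiantsHypothesis

end
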